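import Summits.ValiantsHypothesis.ValiantsHypothesis.Theorems.DegreeDialDesignRung
import HarnessLib

/-!
# DegreeDial rung R1⁺: polynomial support — the Reed–Solomon design tensor at `d = ⌊log₂ n⌋` is not
# a sum of `≤ n^{1/K(c)}` ordered set-multilinear ABPs of total width `n^c`

Sharpening of `designBeyondBalancing_polylogSupport` (rung R1, support `t ≤ d^a`) to the CEILING of the
balanced-segment rank engine: for every `c` there are arbitrarily large `m` such that the block tensor of
`NW_{m+1, d, d/2}`, `d = ⌊log₂(m+1)⌋`, is not `IsSumOrderedT t ((m+2)^c)` for any number of summands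
`t` with `t^{K(c)} ≤ m + 1`, `K(c) = 4·(1024(c+1))²` (`designBeyondBalancing_polySupport`).  Why this is
the engine's ceiling and not an artefact: the engine cuts each of the `t` orders into `q` segments of
`r` consecutive blocks (`d = q·r`) and balances all `t` orders at once, which needs the union bound
`t·(d+1) < 2^q` (`balancedSegments`), i.e. `t < n^{1/r}` up to the factor `d+1`; the deficiency it earns
is `(m+1)^{q⌊√r/32⌋/4}` against the width cost `W^{q+1}`, so beating `W = n^c` forces `√r ≳ 64c`, hence
`r ≳ (64c)²` and supports at most `n^{O(1/c²)}`.  Averaging the rank bound over all balanced cuts instead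
of a union bound gives the same threshold (the non-deficient cuts of one order have density `2^{-Θ(q)}`),
so the open core of the crux `DesignBeyondBalancing` is exactly the support range
`n^{Θ(1/c²)} < t ≤ n^{c}` — polynomially many summands — where no single balanced cut (and no average
of them) is deficient for all orders simultaneously.

References: P. Chatterjee, D. Kush, S. Saraf, A. Shpilka, *Lower bounds for set-multilinear branching
programs*, CCC 2024 (LIPIcs 300, 20), Thm 1.4, §1.5, Claim 3.3 [cite: ChatterjeeKushSarafShpilka2024];
N. Kayal, C. Saha, R. Saptharishi, STOC 2014, §1 [cite: KayalSahaSaptharishi2014, §1].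
-/

set_option linter.dupNamespace false

noncomputable section

namespace Summit.ValiantsHypothesis.ValiantsHypothesis.Theorems.DegreeDial

open Literature.Computability.AlgebraicComplexity Matrix
open Summit.ValiantsHypothesis.ValiantsHypothesis.Theorems.OrderedCountWindow

/-- **Rung R1⁺ (polynomial support).**  For every `c, m₀` there is `m ≥ m₀` (with `m+1` a prime in
`(2^d, 2^{d+1})`, `d = q·r`, `r = (1024(c+1))²`, `q = 2u` even and large) such that the block-coefficient
tensor of `NW_{m+1,d,d/2}`, `d = ⌊log₂(m+1)⌋`, is not a sum of `t` ordered set-multilinear ABPs of total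
width `(m+2)^c` whenever `t^{4r} ≤ m+1`.  Proof: `t^{4r} ≤ m+1 < 2^{qr+1} ≤ (2^q)^{2r}` gives `t² < 2^q`,
and `(d+1)² < 2^q` by the choice of `u`, so `t·(d+1) < 2^q` and the reservoir inequality
`pow_le_pow_of_isSumOrderedT_design` applies exactly as in rung R1.
[cite: ChatterjeeKushSarafShpilka2024, Thm 1.4, §1.5, Claim 3.3] -/
theorem designBeyondBalancing_polySupport (c m₀ : ℕ) :
    ∃ m : ℕ, m₀ ≤ m ∧ ∀ t : ℕ, t ^ (4 * (1024 * (c + 1)) ^ 2) ≤ m + 1 →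
      ¬ IsSumOrderedT (F := ℂ) t ((m + 2) ^ c)
        (fun j : Fin (Nat.log 2 (m + 1)) → Fin (m + 1) =>
          MvPolynomial.coeff
            (∑ i : Fin (Nat.log 2 (m + 1)),
              Finsupp.single (⟨i, (j i : ZMod (m + 1))⟩ : Σ _ : Fin (Nat.log 2 (m + 1)), ZMod (m + 1)) 1)
            (nwDesign (m + 1) (Nat.log 2 (m + 1)) (Nat.log 2 (m + 1) / 2))) := by
  classical
  -- constants
  obtain ⟨r, hr_def⟩ : ∃ r : ℕ, r = (1024 * (c + 1)) ^ 2 := ⟨_, rfl⟩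
  obtain ⟨u, hu_def⟩ : ∃ u : ℕ, u = 2 * (2 * r) + 2 + (m₀ + 1) := ⟨_, rfl⟩
  obtain ⟨q, hq_def⟩ : ∃ q : ℕ, q = 2 * u := ⟨_, rfl⟩
  obtain ⟨P, hP_def⟩ : ∃ P : ℕ, P = u * r := ⟨_, rfl⟩
  have hN : P + P = q * r := by rw [hP_def, hq_def]; ring
  have hr : 1024 ≤ r := by
    rw [hr_def, pow_two]
    calc (1024 : ℕ) = 1024 * 1 := by norm_num
      _ ≤ 1024 * (c + 1) * (1024 * (c + 1)) := by nlinarith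
  have hu1 : 1 ≤ u := by rw [hu_def]; omega
  have hq1 : 1 ≤ q := by rw [hq_def]; omega
  have hdpos : 1 ≤ P + P := by rw [hN]; nlinarith
  -- `(d + 1)² < 2^q`: from `2r·u + 1 < 2^u`
  have hdu : P + P + 1 < 2 ^ u := by
    rw [hN, hq_def, show 2 * u * r = 2 * r * u by ring]
    exact lin_lt_two_pow (2 * r) (by omega)
  have hd2 : (P + P + 1) ^ 2 < 2 ^ q := by
    rw [hq_def, mul_comm 2 u, pow_mul]
    exact Nat.pow_lt_pow_left hdu (by norm_num)
  -- a prime `m + 1 ∈ (2^d, 2^{d+1})`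
  obtain ⟨p, hp, hlt, hle⟩ := Nat.exists_prime_lt_and_le_two_mul (2 ^ (P + P)) (by positivity)
  obtain ⟨m, rfl⟩ := Nat.exists_eq_succ_of_ne_zero hp.ne_zero
  rw [Nat.succ_eq_add_one] at hp hlt hle
  have hlt2 : m + 1 < 2 ^ (P + P + 1) := by
    rcases lt_or_eq_of_le hle with h | h
    · rw [pow_succ]; omega
    · exfalso
      have h2 : 2 ∣ m + 1 := ⟨2 ^ (P + P), by rw [h]⟩
      rcases (Nat.Prime.eq_one_or_self_of_dvd hp 2 h2) with h' | h'
      · norm_num at h'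
      · have : 2 ^ (P + P) = 1 := by omega
        rw [Nat.pow_eq_one] at this
        omega
  have hlog : Nat.log 2 (m + 1) = P + P := Nat.log_eq_of_pow_le_of_lt_pow hlt.le hlt2
  have hdm : P + P ≤ m + 1 := ((Nat.lt_two_pow_self).le.trans hlt.le)
  have hm₀ : m₀ ≤ m := by
    have h1 : m₀ + 1 ≤ P + P := by rw [hN, hq_def, hu_def]; nlinarith
    have h2 : P + P < 2 ^ (P + P) := Nat.lt_two_pow_self
    omega
  refine ⟨m, hm₀, fun t ht h' => ?_⟩
  -- rewrite `d = ⌊log₂(m+1)⌋ = P + P` and `d / 2 = P` in the statement's tensor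
  rw [hlog, show (P + P) / 2 = P by omega] at h'
  -- few summands: `t² < 2^q` from `t^{4r} ≤ m + 1 < 2^{qr+1} ≤ (2^q)^{2r}`
  have hK : 4 * (1024 * (c + 1)) ^ 2 = 2 * (2 * r) := by rw [hr_def]; ring
  rw [hK] at ht
  have ht2 : t ^ 2 < 2 ^ q := by
    have h1 : (t ^ 2) ^ (2 * r) < (2 ^ q) ^ (2 * r) := by
      calc (t ^ 2) ^ (2 * r) = t ^ (2 * (2 * r)) := by rw [← pow_mul]
        _ ≤ m + 1 := ht
        _ < 2 ^ (P + P + 1) := hlt2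
        _ ≤ 2 ^ (q * (2 * r)) := Nat.pow_le_pow_right (by norm_num) (by rw [hN]; nlinarith)
        _ = (2 ^ q) ^ (2 * r) := by rw [pow_mul]
    exact (Nat.pow_lt_pow_iff_left (by omega)).mp h1
  have ht' : t * (P + P + 1) < 2 ^ q := by
    rcases le_total t (P + P + 1) with h | h
    · calc t * (P + P + 1) ≤ (P + P + 1) * (P + P + 1) := Nat.mul_le_mul_right _ h
        _ = (P + P + 1) ^ 2 := by ring
        _ < 2 ^ q := hd2
    · calc t * (P + P + 1) ≤ t * t := Nat.mul_le_mul_left _ h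
        _ = t ^ 2 := by ring
        _ < 2 ^ q := ht2
  have hmain := pow_le_pow_of_isSumOrderedT_design hp hdm hN hr ht' h'
  -- evaluate the exponent: `⌊√r⌋ = 1024(c+1)`, `q · 32(c+1) / 4 = 8q(c+1)`
  have hsqrt : Nat.sqrt r = 1024 * (c + 1) := by rw [hr_def, Nat.sqrt_eq']
  have hexp : q * (Nat.sqrt r / 32) / 4 = 8 * q * (c + 1) := by
    rw [hsqrt, show 1024 * (c + 1) = 32 * (32 * (c + 1)) by ring,
      Nat.mul_div_cancel_left _ (by norm_num : 0 < 32),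
      show q * (32 * (c + 1)) = 4 * (8 * q * (c + 1)) by ring,
      Nat.mul_div_cancel_left _ (by norm_num : 0 < 4)]
  rw [hexp] at hmain
  -- `(m+2)^c ≤ (m+1)^{2c}` and `2c(q+1) < 8q(c+1)` contradict `hmain`
  have hW : (m + 2) ^ c ≤ (m + 1) ^ (2 * c) := by
    rw [pow_mul]
    exact Nat.pow_le_pow_left (by nlinarith) c
  have hlt3 : ((m + 2) ^ c) ^ (q + 1) < (m + 1) ^ (8 * q * (c + 1)) := by
    calc ((m + 2) ^ c) ^ (q + 1) ≤ ((m + 1) ^ (2 * c)) ^ (q + 1) := Nat.pow_le_pow_left hW _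
      _ = (m + 1) ^ (2 * c * (q + 1)) := by rw [← pow_mul]
      _ < (m + 1) ^ (8 * q * (c + 1)) := Nat.pow_lt_pow_right (by omega) (by nlinarith)
  exact absurd (hmain.trans_lt hlt3) (lt_irrefl _)

end Summit.ValiantsHypothesis.ValiantsHypothesis.Theorems.DegreeDial

end
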